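import Summits.ABC.ABC.Theses.IneffectiveSubspace
import Summits.ABC.ABC.Theses.NegOmegaAtlas

/-!
# Strategist workfile r1 (seat `planner-cstrat-stmt-ABC-14937-r1-0`, 2026-08-17) for the crux
# `UniformSadicTowerFour` (stmt-ABC-14937, route `IneffectiveSubspace`, rank 2)

Companion of `Cruxes/UniformSadicTowerFour/STRATEGY-CENSUS.md`, section "Generation r1".
TYPING ONLY: every declaration below is a `def … : Prop` (no theorem is claimed proved here);
the census says which are THEOREMS of the literature, which are the typed OPEN corners, and which
implication is offered to provers as a `--supports stmt-ABC-14937` target.  Vocabulary is kept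
self-contained (the rung-3 statement `RungThree` is verbatim the left side of the landed
`Theorems…ThreeSlotParity.boundedOmegaAt_three_iff_shapes_two`, p161472).

* `OneFreePrimeCell P` — abc on triples whose support has AT MOST ONE prime `> P` ("all but one
  prime frozen").  Claimed THEOREM for every `P` (effective): Shorey–Tijdeman 1986 Thm 12.1
  (`a x^m − b y^n = k`, `a,b,k,x` `P`-smooth ⇒ everything bounded) when the free prime enters with
  exponent `≥ 2`, Baker/Matveev in the fixed logarithms `{log p : p ≤ P}` + Yu at the fixed primes
  `≤ P` when it enters with exponent `1`.  A rung strictly between Mahler (fixed support, landed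
  `abc_fixedSupport`) and `BoundedOmegaABC`; not in the tree; needs the ST fact as a Literature cite.
* The four corners of RUNG 3 (`W = 3`, cells `{2, p, q}`) in which a counterexample must live:
  `PPRTwoMinusFamily` / `PPRTwoPlusFamily` (abc-violators among `(1, 2^x − 1, 2^x)`,
  `(1, 2^x, 2^x + 1)` with `ω ≤ 3` — the route's crux #3 `PrimePowerRadical` at the single base 2),
  `NLFermatFamily` (Nagell–Ljunggren over Fermat primes: `Φ_ℓ(F) = q^y`, `y ≥ 3`, `ℓ ≥ 5`),
  `LargeLargeC2` / `LargeLargeC2'` (`p^x + q^y = 2^z`, `2^x + q^y = r^z` with BOTH odd exponents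
  unbounded along the family — the Lang–Waldschmidt two-logarithm corner).
* `RungThreeAtlas` — the claimed structure theorem `¬RungThree → (corner₁ ∨ … ∨ corner₅)`,
  provable from p161472 + Shorey–Tijdeman Thm 12.2 (fact) + Ridout (tree: `Ridout.padicRoth_int`)
  + a two-logarithm lower bound (tree: the UPD/Yu stack) + Zsigmondy (fact); offered to provers.
-/

set_option linter.dupNamespace false

noncomputable section

namespace Summit.ABC.ABC.Cruxes.UniformSadicTowerFour.StrategistR1

open Literature.NumberTheory.DiophantineGeometry (IsABCTriple rad quality)

/-- RUNG 3 of `BoundedOmegaABC` in constant form: abc with `C = C(ε)` on `{ω(abc) ≤ 3}`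
(verbatim the left side of `boundedOmegaAt_three_iff_shapes_two`). [folklore] -/
def RungThree : Prop :=
  ∀ ε : ℝ, 0 < ε → ∃ C : ℝ, 0 < C ∧ ∀ a b c : ℕ, IsABCTriple a b c →
    (a * b * c).primeFactors.card ≤ 3 → (c : ℝ) < C * ((rad a b c : ℕ) : ℝ) ^ (1 + ε)

/-- **One-free-prime cell.** abc, constant `C(P, ε)`, on the triples whose support contains at
most ONE prime exceeding `P` (any number of primes `≤ P`, any exponents).  Claimed theorem for every
`P` (Shorey–Tijdeman 1986 Thm 12.1 + fixed-logarithm Baker/Yu); uniform in the one moving prime.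
[cite: ShoreyTijdeman1986, Thm 12.1] -/
def OneFreePrimeCell (P : ℕ) : Prop :=
  ∀ ε : ℝ, 0 < ε → ∃ C : ℝ, 0 < C ∧ ∀ a b c : ℕ, IsABCTriple a b c →
    ((a * b * c).primeFactors.filter (fun p => P < p)).card ≤ 1 →
      (c : ℝ) < C * ((rad a b c : ℕ) : ℝ) ^ (1 + ε)

/-- Corner 1 (crux #3 at base 2, minus side): infinitely many `x` for which the triple
`(1, 2^x − 1, 2^x)` has `ω ≤ 3` and quality `> 1 + δ` — i.e. `2^x − 1 = p^y q^z` with a large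
powerful excess (Wieferich-type primes of small order). [folklore] -/
def PPRTwoMinusFamily : Prop :=
  ∃ δ : ℝ, 0 < δ ∧ {x : ℕ | 2 ≤ x ∧ ((2 ^ x - 1) * 2 ^ x).primeFactors.card ≤ 3 ∧
    1 + δ < quality 1 (2 ^ x - 1) (2 ^ x)}.Infinite

/-- Corner 1 (plus side): infinitely many `x` with `(1, 2^x, 2^x + 1)` of `ω ≤ 3` and quality
`> 1 + δ` — `2^x + 1 = q^y r^z` with a large powerful excess. [folklore] -/
def PPRTwoPlusFamily : Prop :=
  ∃ δ : ℝ, 0 < δ ∧ {x : ℕ | 1 ≤ x ∧ (2 ^ x * (2 ^ x + 1)).primeFactors.card ≤ 3 ∧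
    1 + δ < quality 1 (2 ^ x) (2 ^ x + 1)}.Infinite

/-- Corner 2 (Nagell–Ljunggren over Fermat primes): infinitely many `(F, ℓ, q, y)` with `F` a
prime of the form `2^j + 1`, `ℓ ≥ 5` prime, `q` prime, `y ≥ 3` and `F^ℓ − 1 = (F − 1) · q^y`
(i.e. `Φ_ℓ(F) = q^y`).  Each such solution is an `ω = 3` triple `(1, F^ℓ − 1, F^ℓ)` of quality
`> 15/8`; `y = 2` is Ljunggren's theorem, `ℓ = 3` Nagell's, `F` fixed Shorey–Tijdeman 12.5(i).
[cite: ShoreyTijdeman1986, Thm 12.5] -/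
def NLFermatFamily : Prop :=
  {t : ℕ × ℕ × ℕ × ℕ | t.1.Prime ∧ (∃ j : ℕ, t.1 = 2 ^ j + 1) ∧ t.2.1.Prime ∧ 5 ≤ t.2.1 ∧
    t.2.2.1.Prime ∧ 3 ≤ t.2.2.2 ∧ t.1 ^ t.2.1 - 1 = (t.1 - 1) * t.2.2.1 ^ t.2.2.2}.Infinite

/-- Corner 3 (two-logarithm corner, family C2): for some `δ > 0` and EVERY exponent floor `M`,
infinitely many `p^x + q^y = 2^z` (`p ≠ q` odd primes) with `x, y ≥ M` and quality `> 1 + δ`.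
(One bounded odd exponent is excluded by Shorey–Tijdeman Thm 12.2 / Ridout; a common prime factor
`≥ 5` of `x, y` by Ribet 1997.) [cite: ShoreyTijdeman1986, Thm 12.2] -/
def LargeLargeC2 : Prop :=
  ∃ δ : ℝ, 0 < δ ∧ ∀ M : ℕ, {t : ℕ × ℕ × ℕ × ℕ × ℕ | t.1.Prime ∧ t.2.1.Prime ∧ t.1 ≠ t.2.1 ∧
    t.1 ≠ 2 ∧ t.2.1 ≠ 2 ∧ M ≤ t.2.2.1 ∧ M ≤ t.2.2.2.1 ∧
    t.1 ^ t.2.2.1 + t.2.1 ^ t.2.2.2.1 = 2 ^ t.2.2.2.2 ∧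
    1 + δ < quality (t.1 ^ t.2.2.1) (t.2.1 ^ t.2.2.2.1) (2 ^ t.2.2.2.2)}.Infinite

/-- Corner 3' (two-logarithm corner, family C2'): for some `δ > 0` and every floor `M`, infinitely
many `2^x + q^y = r^z` (`q, r` odd primes) with `y, z ≥ M` and quality `> 1 + δ` (contains the
bounded-`x` Pillai families `r^z − q^y = 2^{x₀}`). [cite: ShoreyTijdeman1986, Thm 12.2] -/
def LargeLargeC2' : Prop :=
  ∃ δ : ℝ, 0 < δ ∧ ∀ M : ℕ, {t : ℕ × ℕ × ℕ × ℕ × ℕ | t.1.Prime ∧ t.2.1.Prime ∧ t.1 ≠ 2 ∧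
    t.2.1 ≠ 2 ∧ M ≤ t.2.2.2.1 ∧ M ≤ t.2.2.2.2 ∧
    2 ^ t.2.2.1 + t.1 ^ t.2.2.2.1 = t.2.1 ^ t.2.2.2.2 ∧
    1 + δ < quality (2 ^ t.2.2.1) (t.1 ^ t.2.2.2.1) (t.2.1 ^ t.2.2.2.2)}.Infinite

/-- **RUNG-3 ATLAS (claimed structure theorem, offered to provers `--supports stmt-ABC-14937`):**
a counterexample to rung 3 lives in one of the five named corners.  Ingredients: the six 2-pinned
shapes (p161472); Shorey–Tijdeman Thm 12.2 kills every sub-family with ONE bounded odd exponent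
`≥ 2`; Ridout (tree) + a two-logarithm bound (tree) kill the exponent-`1` sub-families; Zsigmondy
reduces shapes `1 + 2^x q^y = r^z`, `1 + p^x = 2^y r^z` with both exponents large to `NLFermatFamily`;
shapes `1 + p^x q^y = 2^z`, `1 + 2^x = q^y r^z` are the base-2 corners verbatim. [folklore] -/
def RungThreeAtlas : Prop :=
  ¬ RungThree →
    PPRTwoMinusFamily ∨ PPRTwoPlusFamily ∨ NLFermatFamily ∨ LargeLargeC2 ∨ LargeLargeC2'

/-- Sanity composition (trivial logic): the atlas plus the finiteness of the five corners gives
rung 3. [folklore] -/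
theorem rungThree_of_atlas (hA : RungThreeAtlas) (h₁ : ¬ PPRTwoMinusFamily)
    (h₂ : ¬ PPRTwoPlusFamily) (h₃ : ¬ NLFermatFamily) (h₄ : ¬ LargeLargeC2)
    (h₅ : ¬ LargeLargeC2') : RungThree := by
  by_contra h
  rcases hA h with h | h | h | h | h <;> contradiction

/-- Rung 3 is necessary for the crux's normal form: `RungThree` is the `W = 3` instance of
`BoundedOmegaABC` (for the record; the crux needs every `W`). [folklore] -/
theorem rungThree_iff_not_threeSlotFamily_shape :
    RungThree ↔ ∀ ε : ℝ, 0 < ε → ∃ C : ℝ, 0 < C ∧ ∀ a b c : ℕ, IsABCTriple a b c →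
      (a * b * c).primeFactors.card ≤ 3 → (c : ℝ) < C * ((rad a b c : ℕ) : ℝ) ^ (1 + ε) :=
  Iff.rfl

end Summit.ABC.ABC.Cruxes.UniformSadicTowerFour.StrategistR1

end
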